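import Literature.MathematicalPhysics.QuantumFieldTheory.Balaban1983to89.T4HistoryLipschitzActivity
import Summits.QuantumFields.BalabanUV.T4Continuum.Support.NE9FormGaussian

/-!
# NE4GaussianCouplingTwoPoint — row NE9's inline COUPLING TWO-POINT clause `hCup` of
# `NE9LastCouplingBridge.ne9_and_fadingMemory_of_couplingTwoPoint` PRODUCED, for a family of (2.14)-form Gaussian activities,
# from row NE9's Gaussian-letters END `NE9FormGaussian.norm_formAct_sub_formAct_le_gaussian`, in the coordinate `t = g⁻²`
# (cell `pub-balaban`, T⁴-continuum fan-out, `HOME/BINDER-OWNERS.md` row NE4 = spine node U2, owner lineage t4-ne4-p1,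
# generation 33; the consumer-side instantiation named in row NE9's `CARVER-NOTES-NE9-P1-g20.md` §5 (iii))

HONEST FRAMING (T4-DAG PAGE 1).  The cell's T⁴ target is rung (B)+1: existence AND uniqueness of the ε → 0 limit of
gauge-invariant observables on a FIXED finite torus — NOT infinite volume, NOT a mass gap, NOT the Clay problem.  NE9
(`T4OutputRate.NE9` ∧ `FadingMemory`) and NE4 are cell NEW ESTIMATES, NOT PRINTED in [Balaban1987RG1]–[Balaban1989LargeFieldII]
and NOT PROVED here or anywhere in the tree (spine estimates proved: 0/9, unchanged by this module).  This module is
bookkeeping over elementary Gaussian measure theory on finite-dimensional real inner product spaces (the currency of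
`NE9FormGaussian`) and the ABSTRACT cluster geometry `T4HistoryLipschitzActivity.ClusterGeom`; it asserts NOTHING about
Bałaban's functionals.  [II] = [Balaban1988RG2Cluster], [I] = [Balaban1987RG1] are quoted for the TYPE of displayed
hypotheses only (ABSOLUTE RULE).  `FlowStep.BetaPertH`, (B), (B^μ) do not occur.

WHERE THIS SITS.  Node U2 (row NE4) consumes row NE9's Summits END `NE9LastCouplingBridge.ne9_and_fadingMemory_of_couplingTwoPoint`
BY NAME (`NE4ReadOutSocket` p202738 and its two siblings), passing its inline hypothesis COUPLING TWO-POINT (`hCup`: on the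
window, at every step/background/domain, for every admissible old-term configuration and every polymer of the step volume,
the activity at one coupling is bounded by the common majorant at the other, and the difference of the activities at two
couplings is `≤ clip k·|g k − g′ k|·` that majorant) through VERBATIM as a binder.  Row NE9's generation 20 proved, for ONE
(2.14)-form activity `H_s = ∫ 1_{S(s)}·pre·exp(Σ_m a_m(s)F_m(s • φ)) d𝒩` over a standard Gaussian (`C = T²`), the
activity-level bound `‖H_s − H_{s′}‖ ≤ (4|s − s′|/(c·min(s,s′)))·M₁·Π + Σ_{b ∈ sb ∪ lb} M₀·Π·2ε₁|s⁻¹ − s′⁻¹|/√(2π‖Tu_b‖²)` from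
three printed-TYPE inputs only (analyticity of the tables on the `(1+c)ε₁` polydisc; box bounds; the (2.15)–(2.22)-type
domination by a tilted Gaussian density) — `NE9FormGaussian.norm_formAct_sub_formAct_le_gaussian` (p204271).  THIS LEAF is
the plumbing from that END to the bridge's binder: (§1) one activity read in the β-recursion's own coordinate `t = g⁻²`
([I] (0.20): coupling `s = (√t)⁻¹`, `t ≥ γ⁻²` iff `s ∈ ]0, γ]`), SIZE `‖H_s‖ ≤ M₀·Π` and MODULUS `≤ K_t·|t − t′|` with the
coupling-free constant `K_t = (4M₁Π/c)(γ²/2) + (Σ_b M₀Π·2ε₁/√(2π‖Tu_b‖²))(γ/2)` (the two coupling moduli are bounded in `t` on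
`]0, γ]`: `NE9FluctuationStep.inv_min_mul_abs_sub_le`, `NE9CutoffShell.inv_sub_inv_le` — the conversion row NE9 announced as
`NE9FormGaussian` v1.1 §4); (§2) for a FAMILY of such activities indexed by (step `k`, background `U`, old terms `Q`,
polymer `p`) — the bridge's `act k t U Q p` (displayed equation `hact`) — the clause `hCup` itself, under two displayed
COMPARISONS of the Gaussian constants with the bridge's common majorant `n` and modulus ratio `clip`.

CURRENCY (honest).  The Gaussian letters give a modulus that is Lipschitz in `t = g⁻²` with a coupling-free constant and NOT
in the coupling `g` itself (`|s − s′|/min(s, s′)` is unbounded per unit of `|s − s′|` as `s → 0`; tree no-go for the g-form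
from analytic letters: `T4CouplingAnalyticity.exists_couplingAnalyticRel_not_ne9Window`).  Hence the histories of §2 are
t-HISTORIES (a window `Wt` above the floor `γ⁻²`), `|g k − g′ k|` is a t-difference, and the consuming socket
(`NE4ReadOutSocketGaussian`) reads β through `T4CurrencyMatching.reparam invSq` and closes node U2 with the t-currency's weight `1`.

WHAT REMAINS DISPLAYED after this leaf, per index of the class `Idx` ⊇ {(k, U, Q, p) : Q ∈ 𝒜 k, p ∈ vol X, scale X = k+1}:
(i) `F k U Q p m` holomorphic on the `(1+c)ε₁` polydisc [[II] (1.34)/Lemma 1–2 TYPE at `ε₁ ↦ (1+c)ε₁`]; (ii) the coupling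
factors `ac m` holomorphic on every dilation domain of the window [powers of the coupling,
`NE9DilatedTables.differentiableOn_zpow_dilationDomain`]; (iii) box bounds `e`, `e₁` on the cut-off sets / common regions
[(1.36)/(1.43)/(2.20) TYPE]; (iv) the two dominations by `M₀`, `M₁` times `exp(½α‖Tz‖² + ⟨h, Tz⟩)`, `0 ≤ α`, `αt_i² < 1`
[(2.15)–(2.22) TYPE, the smallness of `α₅‖C‖` p. 17]; measurability; the link `‖ℓ_b(φ z)‖ ≤ |⟨u_b, Tz⟩|` (an identity for
Bałaban's `B`, row NE9's (R-10)); and the two COMPARISONS (size) `M₀·Π ≤ n k t′ U p`, (modulus) `K_t ≤ clip k·n k t′ U p` on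
the t-box — row NE9's residual line `M₀·Π ≤ (2.38)-majorant` ((2.25)–(2.26)→(2.38), PROOF-INTERIOR of (B)), NOT discharged.
INSTANTIATION SHAPE (this module's modelling choice, binders displayed): ONE finite-dimensional fluctuation space `ED p` per
polymer, a symmetric covariance root `TT k U p`, ONE scalar bond functional `z ↦ ⟨ub b, Tz⟩` per cut-off bond (row NE9's
(R-9): `dim 𝔤 > 1` radial shells, `NE9RadialShell`, are not used here), small-field bonds `sb p ⊇ ab p`, large-field bonds
`lb p`, the coupling entering ONLY through the thresholds `ε₁/s` and the (2.12) dilation structure of the tables.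

WHAT IS PROVED: bookkeeping — `coupling_of_tCoord` (`s = (√t)⁻¹ ∈ ]0, γ]`, `s⁻² = t`), `gaussian_size_and_twoPoint_tCoord`
(§1: `NE9LocalTwoPoint.norm_formAct_le_local` + `NE9FormGaussian.integral_indicator_dominated_le` for the size; the END + the
two conversions for the modulus), `couplingTwoPoint_of_gaussian` (§2: the clause, literally the binder `hCup` of the bridge
with `act`/`n`/`clip` the family's).  0 sorry; axioms ⊆ {propext, Classical.choice, Quot.sound}; imports the LANDED
`Support/NE9FormGaussian` (p204271) and the tree's `T4HistoryLipschitzActivity`, modifies nothing.  NOT COVERED: any instance of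
a binder for Bałaban's objects; NE9, NE5, NE4; the comparisons with the (2.38)-majorant; rung (B)+1 finite T⁴ only; NOT
summit progress; 0/9 → 0/9.

References (TYPES only): [Balaban1988RG2Cluster] T. Bałaban, CMP 116 (1988) 1–22: (1.34) p. 9, Lemma 2 p. 11, (2.3) p. 12,
(2.14)–(2.15) p. 15, (2.20)–(2.22) p. 16, (2.23)–(2.26) p. 17, Lemma 3 (2.38) p. 20; [Balaban1987RG1] CMP 109 (1987):
(0.20) p. 256, (2.12) p. 268, Thm 1 p. 259 (the window `]0, γ]`).
-/

noncomputable section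

namespace Summit.QuantumFields.BalabanUV.T4Continuum.NE4GaussianCouplingTwoPoint

open MeasureTheory ProbabilityTheory
open scoped BigOperators RealInnerProductSpace
open Literature.MathematicalPhysics.QuantumFieldTheory.Balaban1983to89
open T4OutputRate (Carriers)
open T4HistoryLipschitzActivity (ClusterGeom)
open NE9CouplingTwoPoint (formAct)
open NE9LocalTwoPoint (cutoffLF norm_formAct_le_local)
open NE9DilatedTables (smallFieldPolydisc dilationDomain dilTables)
open NE9TiltedProduct (tiltConst tiltConst_pos)
open NE9FormGaussian (integrable_of_dominated integral_indicator_dominated_le measurableSet_cutoffLF_inner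
  norm_formAct_sub_formAct_le_gaussian)

variable {C : Carriers}

/-! ## §1 One (2.14)-form Gaussian activity read in the coordinate t = g⁻²: size and modulus -/

section Gaussian

variable {E : Type*} [NormedAddCommGroup E] [InnerProductSpace ℝ E] [FiniteDimensional ℝ E] [MeasurableSpace E]
  [BorelSpace E]

/-- The coupling of a t-coordinate above the floor `γ⁻²`: `s = (√t)⁻¹` lies in `]0, γ]` and `s⁻² = t`. [folklore] -/
theorem coupling_of_tCoord {γ t : ℝ} (hγ : 0 < γ) (ht : (γ ^ 2)⁻¹ ≤ t) :
    0 < (Real.sqrt t)⁻¹ ∧ (Real.sqrt t)⁻¹ ≤ γ ∧ (((Real.sqrt t)⁻¹) ^ 2)⁻¹ = t := by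
  have htpos : 0 < t := (inv_pos.2 (pow_pos hγ 2)).trans_le ht
  have hsq : 0 < Real.sqrt t := Real.sqrt_pos.2 htpos
  refine ⟨inv_pos.2 hsq, ?_, ?_⟩
  · rw [inv_le_comm₀ hsq hγ]
    calc γ⁻¹ = Real.sqrt ((γ ^ 2)⁻¹) := by rw [Real.sqrt_inv, Real.sqrt_sq hγ.le]
      _ ≤ Real.sqrt t := Real.sqrt_le_sqrt ht
  · rw [inv_pow, inv_inv, Real.sq_sqrt htpos.le]

/-- **ONE (2.14)-FORM ACTIVITY IN GAUSSIAN LETTERS, READ IN THE COORDINATE `t = g⁻²` (kernel composition).**  For the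
Gaussian datum of `NE9FormGaussian.norm_formAct_sub_formAct_le_gaussian` with its hypotheses asked on the whole coupling
window `]0, γ]` — (i) tables holomorphic on the `(1+c)ε₁` polydisc, (ii) coupling factors holomorphic on every dilation
domain of the window, (iii) box bounds `ê` on the cut-off sets and `ê₁` (dilated) on the common regions, (iv) the two
dominations by a tilted Gaussian density, measurability, `0 < γ` — and two t-coordinates `t, t′ ≥ γ⁻²` with couplings
`s = (√t)⁻¹`, `s′ = (√t′)⁻¹ ∈ ]0, γ]`: the SIZE `‖H_s‖ ≤ M₀·Π` (cut-off dropped, `NE9FormGaussian.integral_indicator_dominated_le`)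
and the MODULUS `‖H_s − H_{s′}‖ ≤ ((4M₁Π/c)(γ²/2) + (Σ_{b ∈ sb ∪ lb} M₀Π·2ε₁/√(2π‖Tu_b‖²))(γ/2))·|t − t′|` — the END bound
of `NE9FormGaussian` with its two coupling moduli converted to `t` (`NE9FluctuationStep.inv_min_mul_abs_sub_le`,
`NE9CutoffShell.inv_sub_inv_le`), `Π = Π_i tiltConst(αt_i², t_i⟨h, b_i⟩)`.  Nothing about Bałaban's functionals is asserted.
[cite: Balaban1988RG2Cluster, (2.14)-(2.15) p.15, (2.20)-(2.24) pp.16-17; Balaban1987RG1, (0.20) p.256 and (2.12) p.268] -/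
theorem gaussian_size_and_twoPoint_tCoord {T : E →ₗ[ℝ] E} (hT : T.IsSymmetric) {nE : ℕ}
    (hn : Module.finrank ℝ E = nE) {Bd : Type*} [DecidableEq Bd] {sb lb ab : Finset Bd} (ub : Bd → E)
    {Wc : Type*} [NormedAddCommGroup Wc] [NormedSpace ℂ Wc] {Vc : Type*} [NormedAddCommGroup Vc] [NormedSpace ℂ Vc]
    {φ : E → Wc} {ℓ : Bd → Wc →L[ℂ] Vc} {TM : Type*} {terms : Finset TM} {a : TM → ℂ → ℂ} {F : TM → Wc → ℂ}
    {pre : E → ℂ} {e e₁ : E → ℝ} {α ε₁ c γ M₀ M₁ : ℝ} (h : E)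
    (hα0 : 0 ≤ α) (hα : ∀ i, α * (hT.eigenvalues hn i) ^ 2 < 1) (hub : ∀ b ∈ sb ∪ lb, T (ub b) ≠ 0)
    (hprem : Measurable pre) (hem : Measurable e) (he₁m : Measurable e₁)
    (hVs : ∀ s, 0 < s → s ≤ γ → AEStronglyMeasurable (fun z => dilTables terms a F φ s z) (stdGaussian E))
    (he₁ : ∀ z, 0 ≤ e₁ z) (hε : 0 ≤ ε₁) (hc : 0 < c) (hγ : 0 < γ) (hM₀ : 0 ≤ M₀) (hM₁ : 0 ≤ M₁)
    (hab : ab ⊆ sb) (hlink : ∀ z, ∀ b ∈ ab, ‖ℓ b (φ z)‖ ≤ |⟪ub b, T z⟫|)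
    (hF : ∀ m ∈ terms, DifferentiableOn ℂ (F m) (smallFieldPolydisc ab ℓ ((1 + c) * ε₁)))
    (ha : ∀ s s', 0 < s → s ≤ γ → 0 < s' → s' ≤ γ →
      ∀ m ∈ terms, DifferentiableOn ℂ (a m) (dilationDomain (min s s') (max s s') (c * min s s')))
    (hbd : ∀ s, 0 < s → s ≤ γ →
      ∀ z ∈ cutoffLF sb lb (fun b (z : E) => ⟪ub b, T z⟫) ε₁ s, ‖dilTables terms a F φ s z‖ ≤ e z)
    (hdil : ∀ s s', 0 < s → s ≤ γ → 0 < s' → s' ≤ γ →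
      ∀ z ∈ cutoffLF sb lb (fun b (z : E) => ⟪ub b, T z⟫) ε₁ s ∩ cutoffLF sb lb (fun b (z : E) => ⟪ub b, T z⟫) ε₁ s',
        ∀ ζ ∈ dilationDomain (min s s') (max s s') (c * min s s'), ‖dilTables terms a F φ ζ z‖ ≤ e₁ z)
    (hdom₀ : ∀ z, ‖pre z‖ * Real.exp (e z) ≤ M₀ * Real.exp (α / 2 * ‖T z‖ ^ 2 + ⟪h, T z⟫))
    (hdom₁ : ∀ z, ‖pre z‖ * e₁ z * Real.exp (e z) ≤ M₁ * Real.exp (α / 2 * ‖T z‖ ^ 2 + ⟪h, T z⟫))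
    {t t' : ℝ} (ht : (γ ^ 2)⁻¹ ≤ t) (ht' : (γ ^ 2)⁻¹ ≤ t') :
    ‖formAct (stdGaussian E) (cutoffLF sb lb (fun b (z : E) => ⟪ub b, T z⟫) ε₁) pre
        (fun x z => dilTables terms a F φ x z) (Real.sqrt t)⁻¹‖ ≤
        M₀ * ∏ i, tiltConst (α * (hT.eigenvalues hn i) ^ 2) (hT.eigenvalues hn i * ⟪h, hT.eigenvectorBasis hn i⟫) ∧
      ‖formAct (stdGaussian E) (cutoffLF sb lb (fun b (z : E) => ⟪ub b, T z⟫) ε₁) pre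
            (fun x z => dilTables terms a F φ x z) (Real.sqrt t)⁻¹ -
          formAct (stdGaussian E) (cutoffLF sb lb (fun b (z : E) => ⟪ub b, T z⟫) ε₁) pre
            (fun x z => dilTables terms a F φ x z) (Real.sqrt t')⁻¹‖ ≤
        (4 * (M₁ * ∏ i, tiltConst (α * (hT.eigenvalues hn i) ^ 2)
              (hT.eigenvalues hn i * ⟪h, hT.eigenvectorBasis hn i⟫)) / c * (γ ^ 2 / 2) +
          (∑ b ∈ sb ∪ lb, M₀ * (∏ i, tiltConst (α * (hT.eigenvalues hn i) ^ 2)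
              (hT.eigenvalues hn i * ⟪h, hT.eigenvectorBasis hn i⟫)) *
            (2 * ε₁ * (Real.sqrt (2 * Real.pi * ‖T (ub b)‖ ^ 2))⁻¹)) * (γ / 2)) * |t - t'| := by
  set Pt : ℝ := ∏ i, tiltConst (α * (hT.eigenvalues hn i) ^ 2) (hT.eigenvalues hn i * ⟪h, hT.eigenvectorBasis hn i⟫)
    with hPt
  set S : ℝ → Set E := cutoffLF sb lb (fun b (z : E) => ⟪ub b, T z⟫) ε₁ with hSdef
  obtain ⟨hs, hsγ, hs2⟩ := coupling_of_tCoord hγ ht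
  obtain ⟨hs', hs'γ, hs2'⟩ := coupling_of_tCoord hγ ht'
  set s : ℝ := (Real.sqrt t)⁻¹ with hsdef
  set s' : ℝ := (Real.sqrt t')⁻¹ with hs'def
  have hPt0 : 0 ≤ Pt := Finset.prod_nonneg fun i _ => (tiltConst_pos (hα i) _).le
  -- the dominated size function and its integrability
  have hf₀m : Measurable fun z => ‖pre z‖ * Real.exp (e z) := hprem.norm.mul (Real.measurable_exp.comp hem)
  have hf₀ : ∀ z, 0 ≤ ‖pre z‖ * Real.exp (e z) ∧ ‖pre z‖ * Real.exp (e z) ≤ M₀ * Real.exp (α / 2 * ‖T z‖ ^ 2 + ⟪h, T z⟫) :=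
    fun z => ⟨by positivity, hdom₀ z⟩
  have hint₀ : Integrable (fun z => ‖pre z‖ * Real.exp (e z)) (stdGaussian E) :=
    integrable_of_dominated hT hn hα h hf₀m hM₀ hf₀
  refine ⟨?_, ?_⟩
  · -- SIZE: ‖H_s‖ ≤ ∫ 1_{S(s)} ‖pre‖e^{ê} ≤ M₀·Pt
    have hSm : MeasurableSet (S s) := measurableSet_cutoffLF_inner (T := T) sb lb ub ε₁ s
    exact (norm_formAct_le_local hSm hint₀ (hbd s hs hsγ)).trans
      (integral_indicator_dominated_le hT hn hα h hf₀m hM₀ hf₀ hSm)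
  · -- MODULUS: the Gaussian END at (s, s′), then the two conversions to t
    have hG := norm_formAct_sub_formAct_le_gaussian hT hn ub h hα0 hα hub hprem hem he₁m (hVs s hs hsγ) (hVs s' hs' hs'γ)
      he₁ hε hc hs hs' hM₀ hM₁ hab hlink hF (ha s s' hs hsγ hs' hs'γ) (hbd s hs hsγ) (hbd s' hs' hs'γ)
      (hdil s s' hs hsγ hs' hs'γ) hdom₀ hdom₁
    have hconv1 := NE9FluctuationStep.inv_min_mul_abs_sub_le hs hsγ hs' hs'γ
    have hconv2 := NE9CutoffShell.inv_sub_inv_le hs hsγ hs' hs'γ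
    rw [hs2, hs2'] at hconv1 hconv2
    have hmin : 0 < min s s' := lt_min hs hs'
    have hY : ∀ b, 0 ≤ M₀ * Pt * (2 * ε₁ * (Real.sqrt (2 * Real.pi * ‖T (ub b)‖ ^ 2))⁻¹) := fun b => by positivity
    have hsum0 : 0 ≤ ∑ b ∈ sb ∪ lb, M₀ * Pt * (2 * ε₁ * (Real.sqrt (2 * Real.pi * ‖T (ub b)‖ ^ 2))⁻¹) :=
      Finset.sum_nonneg fun b _ => hY b
    have h1 : 4 * |s - s'| / (c * min s s') * (M₁ * Pt) ≤ 4 * (M₁ * Pt) / c * (γ ^ 2 / 2) * |t - t'| := by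
      have heq : 4 * |s - s'| / (c * min s s') * (M₁ * Pt) = 4 * (M₁ * Pt) / c * ((min s s')⁻¹ * |s - s'|) := by
        field_simp
      rw [heq, mul_assoc (4 * (M₁ * Pt) / c)]
      exact mul_le_mul_of_nonneg_left hconv1 (by positivity)
    have h2 : ∑ b ∈ sb ∪ lb, M₀ * Pt * (2 * (ε₁ * |s⁻¹ - s'⁻¹|) * (Real.sqrt (2 * Real.pi * ‖T (ub b)‖ ^ 2))⁻¹) ≤
        (∑ b ∈ sb ∪ lb, M₀ * Pt * (2 * ε₁ * (Real.sqrt (2 * Real.pi * ‖T (ub b)‖ ^ 2))⁻¹)) * (γ / 2) * |t - t'| := by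
      have heq : ∑ b ∈ sb ∪ lb, M₀ * Pt * (2 * (ε₁ * |s⁻¹ - s'⁻¹|) * (Real.sqrt (2 * Real.pi * ‖T (ub b)‖ ^ 2))⁻¹) =
          (∑ b ∈ sb ∪ lb, M₀ * Pt * (2 * ε₁ * (Real.sqrt (2 * Real.pi * ‖T (ub b)‖ ^ 2))⁻¹)) * |s⁻¹ - s'⁻¹| := by
        rw [Finset.sum_mul]
        exact Finset.sum_congr rfl fun b _ => by ring
      rw [heq, mul_assoc _ (γ / 2)]
      exact mul_le_mul_of_nonneg_left hconv2 hsum0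
    exact hG.trans (add_le_add h1 h2) |>.trans (le_of_eq (by ring))

/-! ## §2 The bridge's coupling two-point clause PRODUCED from a family of Gaussian letters -/

/-- **THE BRIDGE's COUPLING TWO-POINT CLAUSE `hCup` PRODUCED FROM A FAMILY OF GAUSSIAN LETTERS (kernel composition).**
Index the activities of `NE9LastCouplingBridge` by (step `k`, background `U`, old terms `Q`, polymer `p`) on an index
class `Idx` containing every `(k, U, Q, p)` the clause quantifies over (`Q ∈ 𝒜 k`, `p ∈ G.vol X`, `scale X = k + 1`), let
the activity be the (2.14)-FORM Gaussian activity of the datum at the coupling `s = (√t)⁻¹` of the history's t-coordinate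
(`hact`; fluctuation space `ED p`, covariance root `TT k U p`, full cut-off on `sb p`/`lb p`, prefactor `pre k U Q p`,
dilation-structured tables), and ask, on `Idx`, the hypotheses of `NE9FormGaussian.norm_formAct_sub_formAct_le_gaussian` on
the whole window `]0, γ]` plus TWO COMPARISONS with the bridge's common majorant `n` on the t-box `[γ⁻², ∞[`: (size)
`M₀·Π ≤ n k t′ U p` and (modulus) `(4M₁Π/c)(γ²/2) + (Σ_b M₀Π·2ε₁/√(2π‖Tu_b‖²))(γ/2) ≤ clip k·n k t′ U p` — the line
`M₀·Π ≤ (2.38)-majorant` of row NE9's residual ledger ((2.25)–(2.26)→(2.38), PROOF-INTERIOR of (B)), displayed, not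
discharged.  Then for t-histories of a window `Wt` above the floor `γ⁻²` the clause `hCup` of
`NE9LastCouplingBridge.ne9_and_fadingMemory_of_couplingTwoPoint` HOLDS, `|g k − g′ k|` read in `t`.  Row NE9's END is not
modified; nothing about Bałaban's functionals is asserted; the instantiation SHAPE (one finite-dimensional fluctuation space
per polymer, one scalar bond functional per cut-off bond) is this module's modelling choice, binders displayed.
[cite: Balaban1988RG2Cluster, (2.14)-(2.15) p.15, (2.20)-(2.24) pp.16-17, Lemma 3 (2.38) p.20; Balaban1987RG1, (0.20) p.256] -/
theorem couplingTwoPoint_of_gaussian (G : ClusterGeom C) {Bg : Type} {Pot : Type*}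
    {ED : G.P → Type*} [∀ p, NormedAddCommGroup (ED p)] [∀ p, InnerProductSpace ℝ (ED p)]
    [∀ p, FiniteDimensional ℝ (ED p)] [∀ p, MeasurableSpace (ED p)] [∀ p, BorelSpace (ED p)]
    {TT : ℕ → Bg → (p : G.P) → ED p →ₗ[ℝ] ED p} (hT : ∀ k U p, (TT k U p).IsSymmetric) {nD : G.P → ℕ}
    (hn : ∀ p, Module.finrank ℝ (ED p) = nD p) {Bd : G.P → Type*} [∀ p, DecidableEq (Bd p)]
    {sb lb ab : (p : G.P) → Finset (Bd p)} (ub : ℕ → Bg → (p : G.P) → Bd p → ED p)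
    {Wc : G.P → Type*} [∀ p, NormedAddCommGroup (Wc p)] [∀ p, NormedSpace ℂ (Wc p)] {Vc : Type*} [NormedAddCommGroup Vc]
    [NormedSpace ℂ Vc] {φc : ℕ → Bg → (p : G.P) → ED p → Wc p} {ℓ : (p : G.P) → Bd p → Wc p →L[ℂ] Vc} {TM : Type*}
    {terms : G.P → Finset TM} {ac : TM → ℂ → ℂ} {F : ℕ → Bg → Pot → (p : G.P) → TM → Wc p → ℂ}
    {pre : ℕ → Bg → Pot → (p : G.P) → ED p → ℂ} {e e₁ : ℕ → Bg → Pot → (p : G.P) → ED p → ℝ}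
    {hh : ℕ → Bg → Pot → (p : G.P) → ED p} {α M₀ M₁ : ℕ → Bg → Pot → G.P → ℝ} {ε₁ c γ : ℝ}
    {𝒜 : ℕ → Set Pot} {Idx : ℕ → Bg → Pot → G.P → Prop} {Wt : Set (ℕ → ℝ)}
    {act : ℕ → ℝ → Bg → Pot → G.P → ℂ} {n : ℕ → ℝ → Bg → G.P → ℝ} {clip : ℕ → ℝ}
    -- the index class and the Gaussian model of the activities (displayed equations)
    (hIdx : ∀ (k : ℕ) (U : Bg) (X : C.Dom), C.scale X = k + 1 → ∀ Q ∈ 𝒜 k, ∀ p ∈ G.vol X, Idx k U Q p)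
    (hact : ∀ k t U Q p, act k t U Q p = formAct (stdGaussian (ED p))
      (cutoffLF (sb p) (lb p) (fun b (z : ED p) => ⟪ub k U p b, TT k U p z⟫) ε₁) (pre k U Q p)
      (fun x z => dilTables (terms p) ac (F k U Q p) (φc k U p) x z) (Real.sqrt t)⁻¹)
    (hWt : ∀ g ∈ Wt, ∀ k, (γ ^ 2)⁻¹ ≤ g k) (hε : 0 ≤ ε₁) (hc : 0 < c) (hγ : 0 < γ) (hab : ∀ p, ab p ⊆ sb p)
    -- (ii) coupling factors [powers of the coupling] on every dilation domain of the window
    (ha : ∀ s s', 0 < s → s ≤ γ → 0 < s' → s' ≤ γ →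
      ∀ m, DifferentiableOn ℂ (ac m) (dilationDomain (min s s') (max s s') (c * min s s')))
    -- per index: tilt admissibility, measurability, signs
    (hα0 : ∀ k U Q p, Idx k U Q p → 0 ≤ α k U Q p)
    (hα : ∀ k U Q p, Idx k U Q p → ∀ i, α k U Q p * ((hT k U p).eigenvalues (hn p) i) ^ 2 < 1)
    (hub : ∀ k U Q p, Idx k U Q p → ∀ b ∈ sb p ∪ lb p, TT k U p (ub k U p b) ≠ 0)
    (hprem : ∀ k U Q p, Idx k U Q p → Measurable (pre k U Q p))
    (hem : ∀ k U Q p, Idx k U Q p → Measurable (e k U Q p)) (he₁m : ∀ k U Q p, Idx k U Q p → Measurable (e₁ k U Q p))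
    (hVs : ∀ k U Q p, Idx k U Q p → ∀ s, 0 < s → s ≤ γ →
      AEStronglyMeasurable (fun z => dilTables (terms p) ac (F k U Q p) (φc k U p) s z) (stdGaussian (ED p)))
    (he₁ : ∀ k U Q p, Idx k U Q p → ∀ z, 0 ≤ e₁ k U Q p z)
    (hM₀ : ∀ k U Q p, Idx k U Q p → 0 ≤ M₀ k U Q p) (hM₁ : ∀ k U Q p, Idx k U Q p → 0 ≤ M₁ k U Q p)
    -- the link between the cut-off's bond variables and the polydisc's bond coordinates
    (hlink : ∀ k U Q p, Idx k U Q p → ∀ z, ∀ b ∈ ab p, ‖ℓ p b (φc k U p z)‖ ≤ |⟪ub k U p b, TT k U p z⟫|)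
    -- (i) analyticity [Lemma 1–2 TYPE at (1+c)ε₁]
    (hF : ∀ k U Q p, Idx k U Q p → ∀ m ∈ terms p,
      DifferentiableOn ℂ (F k U Q p m) (smallFieldPolydisc (ab p) (ℓ p) ((1 + c) * ε₁)))
    -- (iii) box bounds [(1.36)/(1.43)/(2.20) TYPE] on the window
    (hbd : ∀ k U Q p, Idx k U Q p → ∀ s, 0 < s → s ≤ γ →
      ∀ z ∈ cutoffLF (sb p) (lb p) (fun b (z : ED p) => ⟪ub k U p b, TT k U p z⟫) ε₁ s,
        ‖dilTables (terms p) ac (F k U Q p) (φc k U p) s z‖ ≤ e k U Q p z)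
    (hdil : ∀ k U Q p, Idx k U Q p → ∀ s s', 0 < s → s ≤ γ → 0 < s' → s' ≤ γ →
      ∀ z ∈ cutoffLF (sb p) (lb p) (fun b (z : ED p) => ⟪ub k U p b, TT k U p z⟫) ε₁ s ∩
          cutoffLF (sb p) (lb p) (fun b (z : ED p) => ⟪ub k U p b, TT k U p z⟫) ε₁ s',
        ∀ ζ ∈ dilationDomain (min s s') (max s s') (c * min s s'),
          ‖dilTables (terms p) ac (F k U Q p) (φc k U p) ζ z‖ ≤ e₁ k U Q p z)
    -- (iv) DOMINATION [(2.15)–(2.22) TYPE]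
    (hdom₀ : ∀ k U Q p, Idx k U Q p → ∀ z, ‖pre k U Q p z‖ * Real.exp (e k U Q p z) ≤
      M₀ k U Q p * Real.exp (α k U Q p / 2 * ‖TT k U p z‖ ^ 2 + ⟪hh k U Q p, TT k U p z⟫))
    (hdom₁ : ∀ k U Q p, Idx k U Q p → ∀ z, ‖pre k U Q p z‖ * e₁ k U Q p z * Real.exp (e k U Q p z) ≤
      M₁ k U Q p * Real.exp (α k U Q p / 2 * ‖TT k U p z‖ ^ 2 + ⟪hh k U Q p, TT k U p z⟫))
    -- the two comparisons with the common majorant [the line `M₀Π ≤ (2.38)-majorant`, PROOF-INTERIOR of (B)]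
    (hsize : ∀ k U Q p, Idx k U Q p → ∀ t', (γ ^ 2)⁻¹ ≤ t' →
      M₀ k U Q p * ∏ i, tiltConst (α k U Q p * ((hT k U p).eigenvalues (hn p) i) ^ 2)
        ((hT k U p).eigenvalues (hn p) i * ⟪hh k U Q p, (hT k U p).eigenvectorBasis (hn p) i⟫) ≤ n k t' U p)
    (hmod : ∀ k U Q p, Idx k U Q p → ∀ t', (γ ^ 2)⁻¹ ≤ t' →
      4 * (M₁ k U Q p * ∏ i, tiltConst (α k U Q p * ((hT k U p).eigenvalues (hn p) i) ^ 2)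
            ((hT k U p).eigenvalues (hn p) i * ⟪hh k U Q p, (hT k U p).eigenvectorBasis (hn p) i⟫)) / c * (γ ^ 2 / 2) +
        (∑ b ∈ sb p ∪ lb p, M₀ k U Q p *
            (∏ i, tiltConst (α k U Q p * ((hT k U p).eigenvalues (hn p) i) ^ 2)
              ((hT k U p).eigenvalues (hn p) i * ⟪hh k U Q p, (hT k U p).eigenvectorBasis (hn p) i⟫)) *
            (2 * ε₁ * (Real.sqrt (2 * Real.pi * ‖TT k U p (ub k U p b)‖ ^ 2))⁻¹)) * (γ / 2) ≤
        clip k * n k t' U p) :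
    ∀ g ∈ Wt, ∀ g' ∈ Wt, ∀ (k : ℕ) (U : Bg) (X : C.Dom), C.scale X = k + 1 → ∀ Q ∈ 𝒜 k, ∀ p ∈ G.vol X,
      ‖act k (g k) U Q p‖ ≤ n k (g' k) U p ∧
        ‖act k (g k) U Q p - act k (g' k) U Q p‖ ≤ clip k * |g k - g' k| * n k (g' k) U p := by
  intro g hg g' hg' k U X hX Q hQ p hp
  have hI := hIdx k U X hX Q hQ p hp
  have ht := hWt g hg k
  have ht' := hWt g' hg' k
  obtain ⟨h1, h2⟩ := gaussian_size_and_twoPoint_tCoord (hT k U p) (hn p) (ub k U p) (hh k U Q p) (hα0 k U Q p hI)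
    (hα k U Q p hI) (hub k U Q p hI) (hprem k U Q p hI) (hem k U Q p hI) (he₁m k U Q p hI) (hVs k U Q p hI)
    (he₁ k U Q p hI) hε hc hγ (hM₀ k U Q p hI) (hM₁ k U Q p hI) (hab p) (hlink k U Q p hI) (hF k U Q p hI)
    (fun s s' hs hsγ hs' hs'γ m _ => ha s s' hs hsγ hs' hs'γ m) (hbd k U Q p hI) (hdil k U Q p hI) (hdom₀ k U Q p hI)
    (hdom₁ k U Q p hI) ht ht'
  rw [hact, hact]
  refine ⟨h1.trans (hsize k U Q p hI (g' k) ht'), h2.trans ?_⟩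
  have hm := hmod k U Q p hI (g' k) ht'
  calc _ ≤ clip k * n k (g' k) U p * |g k - g' k| := mul_le_mul_of_nonneg_right hm (abs_nonneg _)
    _ = clip k * |g k - g' k| * n k (g' k) U p := by ring

end Gaussian

end Summit.QuantumFields.BalabanUV.T4Continuum.NE4GaussianCouplingTwoPoint

end
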